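import Literature.NumberTheory.EllipticCurves.ZpExtensionEisensteinLocalOrdinaryReadoutProofs
import Literature.NumberTheory.GaloisRepresentations.UnramifiedClassesInertia
import HarnessLib

/-!
# Reading out Howard's UNRAMIFIED cores at `v ∤ p` on the inertia group over `K_∞`, and the descent of the
# saturation exponent down the local tower (proofs file, part 1 of the `v ∤ p` clause)

Topic `NumberTheory/EllipticCurves` (cell `pub/bsd-print-x9`, blueprint HOME/p2/S1-DISCRETE-CONTROL §2 «v ∤ p»; sequel to
`ZpExtensionEisensteinLocalOrdinaryReadoutProofs` (the `v ∣ p` analogue: strict ordinary cores read out modulo `C_v`) and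
`ZpExtensionEisensteinSelmerStructure` (Howard's `F_𝔮` at `v ∤ p`: at `v ∈ S` the level condition of the saturated tower of
UNRAMIFIED cores `H¹_ur(K_v, T^{(j)})`, at `v ∉ S` the unramified classes)). THEOREMS ONLY; no definition, no named fact,
no instance, no `sorry`.

For `E = V/K`, a `ℤ_p`-extension `κ` (`H = ker κ = Gal(K̄/K_∞)`), `m ≥ 1`, the tower `T^{(j)} = E[p^j] ⊗ A_{m,j}(ψ⁻¹)` and a
finite place `v`:

* §1 `exists_eq_coboundary_of_mem_unramifiedSubgroup` (and `exists_cocycle_…`) — a local class in `H¹_ur(K_v, T^{(j)})` has a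
  cocycle whose readout `ι_j ∘ λ_j` is, on the elements of the INERTIA group `I_{K_v}` restricting into `ker κ`, an honest
  coboundary `σ ↦ res σ • w - w` of a point `w ∈ E[p^∞]` (the cocycle is principal on `I_{K_v}`; read out with `λ_j`,
  which is equivariant on `{σ : res σ ∈ ker κ}` where the twist is trivial).
* §2 `exists_cocycle_eq_coboundary_eisensteinLocalReduce`, `exists_cocycle_eq_coboundary_of_compatible` — the same down a
  compatible family of the local tower (the LEVEL CONDITION = saturated tower): descend the saturation exponent using
  `ι ∘ λ_j ∘ red = p · ι ∘ λ_{j+1}` (`inclusion_tailReadout_eisensteinTwistReduce`).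
* Part 2 (`ZpExtensionEisensteinReadoutUnramifiedProofs`) assembles these into: the readout of Howard's condition at
  `v ∤ p` dies on `H ⊓ I_v` (is UNRAMIFIED over `K_∞`), hence — for `v` unramified and finitely decomposed in `K_∞/K`
  (Greenberg–Vatsal: `G_η/I_η` is pro-prime-to-`p`) — lies in the local condition of `Sel_{p^∞}(E/K_∞)` at the place above
  `v` (binder (B4) at `v ∤ p` of the discrete half of the shared μ-crux's `stub_controlGlue`).

References: [Howard2004HeegnerKolyvagin] Def. 3.1.2 (H¹_unr at v ∈ S, propagated), Def. 2.1.1, Def. 2.1.10, Lemma 2.2.7 /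
Prop. 2.2.8; [GreenbergVatsal2000] §2 p. 17; [GreenbergLNM1716] §2 pp. 69–72; [MilneADT2006] Ch. I §2 (unramified
cohomology). BSD is not proved by any of this.
-/

noncomputable section

open scoped Classical ContRepresentation

open NumberField IsDedekindDomain Field
open Literature.NumberTheory.EllipticCurves Literature.NumberTheory.GaloisRepresentations
open Literature.NumberTheory.GaloisRepresentations.galoisCohomology
open Literature.NumberTheory.GaloisCohomology.Howard2004
open Literature.NumberTheory.EllipticCurves.GreenbergSelmer
open IwasawaAlgebra IwasawaAlgebra.EisensteinCoeff

namespace WeierstrassCurve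

variable {K : Type} [Field K] [NumberField K] (V : WeierstrassCurve K) {p : ℕ} [hp : Fact p.Prime]
  (κ : ZpExtension K p) {m : ℕ} (hm : 1 ≤ m) (v : HeightOneSpectrum (𝓞 K))

/-! ## §1 A class in the unramified core: its readout on `I_{K_v} ∩ res⁻¹(ker κ)` is a coboundary -/

/-- **A local class in the unramified core reads out to a coboundary on the inertia elements over `K_∞`.**
If `[η] ∈ H¹_ur(K_v, T^{(j)})` then there is `w ∈ E[p^∞]` with `ι_j(λ_j(η(σ))) = res σ • w − w` for every `σ ∈ I_{K_v}`
restricting into `ker κ` (`η(σ) = σ·w₀ − w₀` on `I_{K_v}`; read out with `λ_j`, equivariant there).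
[cite: Howard2004HeegnerKolyvagin, Def. 3.1.2 (H¹_unr) and Def. 2.1.10] [cite: MilneADT2006, Ch. I §2 (unramified cohomology)] -/
theorem exists_eq_coboundary_of_mem_unramifiedSubgroup (j : ℕ)
    (η : contOneCocycles
      (((κ.unitTwist (-1)).eisensteinTwist (V.torsionGaloisModule ((p : ℤ) ^ j)) hm j).toLocal
        (Sum.inr v : Place K)).toTopRep)
    (hη : oneCocycleClass _ η ∈ DiscreteGaloisModule.unramifiedSubgroup
      (GaloisRep.toLocal v ((κ.unitTwist (-1)).eisensteinTwist (V.torsionGaloisModule ((p : ℤ) ^ j)) hm j)) 1) :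
    ∃ w : V.geomPrimaryTorsion p, ∀ σ : absoluteGaloisGroup (v.adicCompletion K),
      σ ∈ absInertia (v.adicCompletion K) → absGaloisRestrict K (v.adicCompletion K) σ ∈ κ.kerSubgroup →
        AddSubgroup.inclusion (AcSigned.geomTorsion_zpow_le_geomPrimaryTorsion V p j)
            (Twisted.tailReadout p hm j (V.geomTorsion_pow_nsmul_eq_zero p j) (η.1 σ)) =
          absGaloisRestrict K (v.adicCompletion K) σ • w - w := by
  obtain ⟨w₀, hw₀⟩ := (DiscreteGaloisModule.oneCocycleClass_mem_unramifiedSubgroup_iff_exists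
    (GaloisRep.toLocal v ((κ.unitTwist (-1)).eisensteinTwist (V.torsionGaloisModule ((p : ℤ) ^ j)) hm j)) η).1 hη
  refine ⟨AddSubgroup.inclusion (AcSigned.geomTorsion_zpow_le_geomPrimaryTorsion V p j)
    (Twisted.tailReadout p hm j (V.geomTorsion_pow_nsmul_eq_zero p j) w₀), fun σ hσI hσ ↦ ?_⟩
  have h1 : η.1 σ = GaloisRep.toLocal v ((κ.unitTwist (-1)).eisensteinTwist (V.torsionGaloisModule ((p : ℤ) ^ j))
      hm j) σ w₀ - w₀ := hw₀ σ hσI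
  rw [h1, map_sub, map_sub, V.tailReadout_toLocal_apply_of_mem_kerSubgroup κ hm v j hσ]
  rfl

/-- A class of the unramified core, any representative form: `x ∈ H¹_ur(K_v, T^{(j)})` gives a cocycle `η`, `[η] = x`, whose
readout is a coboundary on the inertia elements restricting into `ker κ`. [cite: Howard2004HeegnerKolyvagin, Def. 3.1.2 (H¹_unr)] -/
theorem exists_cocycle_eq_coboundary_of_mem_unramifiedSubgroup (j : ℕ)
    (x : galoisCohomology (((κ.unitTwist (-1)).eisensteinTwist (V.torsionGaloisModule ((p : ℤ) ^ j)) hm j).toLocal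
      (Sum.inr v : Place K)) 1)
    (hx : x ∈ DiscreteGaloisModule.unramifiedSubgroup
      (GaloisRep.toLocal v ((κ.unitTwist (-1)).eisensteinTwist (V.torsionGaloisModule ((p : ℤ) ^ j)) hm j)) 1) :
    ∃ η : contOneCocycles
        (((κ.unitTwist (-1)).eisensteinTwist (V.torsionGaloisModule ((p : ℤ) ^ j)) hm j).toLocal
          (Sum.inr v : Place K)).toTopRep,
      oneCocycleClass _ η = x ∧
      ∃ w : V.geomPrimaryTorsion p, ∀ σ : absoluteGaloisGroup (v.adicCompletion K),
        σ ∈ absInertia (v.adicCompletion K) → absGaloisRestrict K (v.adicCompletion K) σ ∈ κ.kerSubgroup →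
          AddSubgroup.inclusion (AcSigned.geomTorsion_zpow_le_geomPrimaryTorsion V p j)
              (Twisted.tailReadout p hm j (V.geomTorsion_pow_nsmul_eq_zero p j) (η.1 σ)) =
            absGaloisRestrict K (v.adicCompletion K) σ • w - w := by
  obtain ⟨η, rfl⟩ := oneCocycleClass_surjective _ x
  exact ⟨η, rfl, V.exists_eq_coboundary_of_mem_unramifiedSubgroup κ hm v j η hx⟩

/-! ## §2 Descent along the compatible family: `ι ∘ λ_J ∘ red = p · ι ∘ λ_{J+1}` -/

set_option maxHeartbeats 400000 in
/-- **One step of descent.** If `p • x ∈ H¹(K_v, T^{(J+1)})` has a representative whose readout is a coboundary on the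
inertia elements restricting into `ker κ`, then so does `red x ∈ H¹(K_v, T^{(J)})` — because `ι_J(λ_J(red y)) = p · ι_{J+1}(λ_{J+1}(y))`.
[cite: Howard2004HeegnerKolyvagin, §1.6 (arXiv p. 12) and Lemma 2.2.7 / Prop. 2.2.8] -/
theorem exists_cocycle_eq_coboundary_eisensteinLocalReduce (J : ℕ)
    (x : galoisCohomology (((κ.unitTwist (-1)).eisensteinTwist (V.torsionGaloisModule ((p : ℤ) ^ (J + 1))) hm
      (J + 1)).toLocal (Sum.inr v : Place K)) 1)
    (hx : ∃ η : contOneCocycles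
        (((κ.unitTwist (-1)).eisensteinTwist (V.torsionGaloisModule ((p : ℤ) ^ (J + 1))) hm (J + 1)).toLocal
          (Sum.inr v : Place K)).toTopRep,
      oneCocycleClass _ η = p • x ∧
      ∃ w : V.geomPrimaryTorsion p, ∀ σ : absoluteGaloisGroup (v.adicCompletion K),
        σ ∈ absInertia (v.adicCompletion K) → absGaloisRestrict K (v.adicCompletion K) σ ∈ κ.kerSubgroup →
          AddSubgroup.inclusion (AcSigned.geomTorsion_zpow_le_geomPrimaryTorsion V p (J + 1))
              (Twisted.tailReadout p hm (J + 1) (V.geomTorsion_pow_nsmul_eq_zero p (J + 1)) (η.1 σ)) =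
            absGaloisRestrict K (v.adicCompletion K) σ • w - w) :
    ∃ η : contOneCocycles
        (((κ.unitTwist (-1)).eisensteinTwist (V.torsionGaloisModule ((p : ℤ) ^ J)) hm J).toLocal
          (Sum.inr v : Place K)).toTopRep,
      oneCocycleClass _ η =
        (κ.unitTwist (-1)).eisensteinLocalReduce (fun i ↦ V.torsionGaloisModule ((p : ℤ) ^ i))
          (fun i ↦ V.torsionGaloisModuleReduce p i) hm (Sum.inr v) J x ∧
      ∃ w : V.geomPrimaryTorsion p, ∀ σ : absoluteGaloisGroup (v.adicCompletion K),
        σ ∈ absInertia (v.adicCompletion K) → absGaloisRestrict K (v.adicCompletion K) σ ∈ κ.kerSubgroup →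
          AddSubgroup.inclusion (AcSigned.geomTorsion_zpow_le_geomPrimaryTorsion V p J)
              (Twisted.tailReadout p hm J (V.geomTorsion_pow_nsmul_eq_zero p J) (η.1 σ)) =
            absGaloisRestrict K (v.adicCompletion K) σ • w - w := by
  obtain ⟨η, hη, w, hw⟩ := hx
  obtain ⟨η₀, rfl⟩ := oneCocycleClass_surjective _ x
  -- `η - p • η₀` is a coboundary `∂u`
  have hη' : oneCocycleClass _ (η - p • η₀) = 0 := by
    rw [oneCocycleClass_sub, ← oneCocycleClassₗ_apply _ (p • η₀), map_nsmul, oneCocycleClassₗ_apply, hη]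
    exact sub_self _
  rw [oneCocycleClass_eq_zero_iff] at hη'
  obtain ⟨u, hu⟩ := hη'
  -- the reduced cocycle `red ∘ η₀`
  refine ⟨contOneCocycles.pullback (ContinuousMonoidHom.id _)
      (TopRep.ofHom ⟨(Literature.NumberTheory.EllipticCurves.DiscreteGaloisModule.localMap ((κ.unitTwist (-1)).eisensteinTwistReduce hm (Nat.le_succ J)
        (V.torsionGaloisModuleReduce p J)) (Sum.inr v)).toContinuousLinearMap,
        (Literature.NumberTheory.EllipticCurves.DiscreteGaloisModule.localMap ((κ.unitTwist (-1)).eisensteinTwistReduce hm (Nat.le_succ J)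
          (V.torsionGaloisModuleReduce p J)) (Sum.inr v)).isIntertwining'⟩) η₀, ?_,
    w - AddSubgroup.inclusion (AcSigned.geomTorsion_zpow_le_geomPrimaryTorsion V p (J + 1))
      (Twisted.tailReadout p hm (J + 1) (V.geomTorsion_pow_nsmul_eq_zero p (J + 1)) u), fun σ hσI hσ ↦ ?_⟩
  · -- `red [η₀] = [red ∘ η₀]`
    change _ = ContinuousCohomology.map _ _ 1 (oneCocycleClass _ η₀)
    rw [map_oneCocycleClass]
  · -- the readout of `red (η₀ σ)` is `p •` that of `η₀ σ`, and `p • η₀ σ = η σ - (σ u - u)`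
    have hval : (contOneCocycles.pullback (ContinuousMonoidHom.id _)
        (TopRep.ofHom ⟨(Literature.NumberTheory.EllipticCurves.DiscreteGaloisModule.localMap ((κ.unitTwist (-1)).eisensteinTwistReduce hm (Nat.le_succ J)
          (V.torsionGaloisModuleReduce p J)) (Sum.inr v)).toContinuousLinearMap,
          (Literature.NumberTheory.EllipticCurves.DiscreteGaloisModule.localMap ((κ.unitTwist (-1)).eisensteinTwistReduce hm (Nat.le_succ J)
            (V.torsionGaloisModuleReduce p J)) (Sum.inr v)).isIntertwining'⟩) η₀).1 σ =
        (κ.unitTwist (-1)).eisensteinTwistReduce hm (Nat.le_succ J) (V.torsionGaloisModuleReduce p J) (η₀.1 σ) := rfl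
    have hu' : p • η₀.1 σ = η.1 σ -
        (GaloisRep.toLocal v ((κ.unitTwist (-1)).eisensteinTwist (V.torsionGaloisModule ((p : ℤ) ^ (J + 1))) hm
          (J + 1)) σ u - u) := by
      have h := hu σ
      change η.1 σ - p • η₀.1 σ = GaloisRep.toLocal v ((κ.unitTwist (-1)).eisensteinTwist
        (V.torsionGaloisModule ((p : ℤ) ^ (J + 1))) hm (J + 1)) σ u - u at h
      rw [← h, sub_sub_cancel]
    have h1 : AddSubgroup.inclusion (AcSigned.geomTorsion_zpow_le_geomPrimaryTorsion V p (J + 1))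
        (Twisted.tailReadout p hm (J + 1) (V.geomTorsion_pow_nsmul_eq_zero p (J + 1)) (p • η₀.1 σ)) =
        p • AddSubgroup.inclusion (AcSigned.geomTorsion_zpow_le_geomPrimaryTorsion V p (J + 1))
          (Twisted.tailReadout p hm (J + 1) (V.geomTorsion_pow_nsmul_eq_zero p (J + 1)) (η₀.1 σ)) := by
      rw [map_nsmul, map_nsmul]
    rw [hval, V.inclusion_tailReadout_eisensteinTwistReduce κ hm J, ← h1, hu']
    rw [map_sub, map_sub, map_sub, map_sub, V.tailReadout_toLocal_apply_of_mem_kerSubgroup κ hm v (J + 1) hσ]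
    -- bookkeeping in the abelian group `E[p^∞]`
    rw [show ∀ (b : geomTorsion V ((p : ℤ) ^ (J + 1))) (g : absoluteGaloisGroup K),
        AddSubgroup.inclusion (AcSigned.geomTorsion_zpow_le_geomPrimaryTorsion V p (J + 1)) (g • b) =
          g • AddSubgroup.inclusion (AcSigned.geomTorsion_zpow_le_geomPrimaryTorsion V p (J + 1)) b from
        fun _ _ ↦ rfl, hw σ hσI hσ, smul_sub]
    abel

set_option maxHeartbeats 400000 in
/-- **Descent along a compatible family of local classes.** For a compatible family `(x_i)_i` of the local tower at `v`
(`red_i x_{i+1} = x_i`) and `d ≥ 0`: if `p^d • x_{j+d}` has a representative whose readout is a coboundary on the inertia elements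
restricting into `ker κ`, then so does `x_j` (induction on `d` with `exists_cocycle_eq_coboundary_eisensteinLocalReduce`).
[cite: Howard2004HeegnerKolyvagin, Def. 2.1.1 (propagation) and Lemma 2.2.7 / Prop. 2.2.8] -/
theorem exists_cocycle_eq_coboundary_of_compatible (d : ℕ) :
    ∀ (j : ℕ)
      (x : ∀ i, galoisCohomology (((κ.unitTwist (-1)).eisensteinTwist (V.torsionGaloisModule ((p : ℤ) ^ i)) hm i).toLocal
        (Sum.inr v : Place K)) 1),
      (∀ i, (κ.unitTwist (-1)).eisensteinLocalReduce (fun i ↦ V.torsionGaloisModule ((p : ℤ) ^ i))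
          (fun i ↦ V.torsionGaloisModuleReduce p i) hm (Sum.inr v) i (x (i + 1)) = x i) →
      (∃ η : contOneCocycles
          (((κ.unitTwist (-1)).eisensteinTwist (V.torsionGaloisModule ((p : ℤ) ^ (j + d))) hm (j + d)).toLocal
            (Sum.inr v : Place K)).toTopRep,
        oneCocycleClass _ η = p ^ d • x (j + d) ∧
        ∃ w : V.geomPrimaryTorsion p, ∀ σ : absoluteGaloisGroup (v.adicCompletion K),
          σ ∈ absInertia (v.adicCompletion K) → absGaloisRestrict K (v.adicCompletion K) σ ∈ κ.kerSubgroup →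
            AddSubgroup.inclusion (AcSigned.geomTorsion_zpow_le_geomPrimaryTorsion V p (j + d))
                (Twisted.tailReadout p hm (j + d) (V.geomTorsion_pow_nsmul_eq_zero p (j + d)) (η.1 σ)) =
              absGaloisRestrict K (v.adicCompletion K) σ • w - w) →
      ∃ η : contOneCocycles
          (((κ.unitTwist (-1)).eisensteinTwist (V.torsionGaloisModule ((p : ℤ) ^ j)) hm j).toLocal
            (Sum.inr v : Place K)).toTopRep,
        oneCocycleClass _ η = x j ∧
        ∃ w : V.geomPrimaryTorsion p, ∀ σ : absoluteGaloisGroup (v.adicCompletion K),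
          σ ∈ absInertia (v.adicCompletion K) → absGaloisRestrict K (v.adicCompletion K) σ ∈ κ.kerSubgroup →
            AddSubgroup.inclusion (AcSigned.geomTorsion_zpow_le_geomPrimaryTorsion V p j)
                (Twisted.tailReadout p hm j (V.geomTorsion_pow_nsmul_eq_zero p j) (η.1 σ)) =
              absGaloisRestrict K (v.adicCompletion K) σ • w - w := by
  induction d with
  | zero =>
    intro j x _ h
    rw [pow_zero, one_smul] at h
    exact h
  | succ d ih =>
    intro j x hx h
    rw [pow_succ', mul_smul] at h
    have h1 := V.exists_cocycle_eq_coboundary_eisensteinLocalReduce κ hm v (j + d) (p ^ d • x (j + d + 1)) h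
    have h2 : (κ.unitTwist (-1)).eisensteinLocalReduce (fun i ↦ V.torsionGaloisModule ((p : ℤ) ^ i))
        (fun i ↦ V.torsionGaloisModuleReduce p i) hm (Sum.inr v) (j + d) (p ^ d • x (j + d + 1)) =
        p ^ d • x (j + d) := by
      rw [map_nsmul, hx (j + d)]
    rw [h2] at h1
    exact ih j x hx h1

end WeierstrassCurve
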